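import Mathlib
import HarnessLib

/-!
# Format C, L-C1 (polar part): the window Laplace integral `∫_{−a}^{a} e^{(σ + iπn/a)x} dx`

Route context: Fourier–Galerkin / Schur-complement certificates of Weil positivity on a window ("format C";
cell memo `run/shared/lean/pub/rh-explicit/rh-explicit-weil-10/FORMATC-DESIGN.md` §1 (c1), §8.9 (1)(c); sibling
`WeilFormatCShiftedWindowIntegral.lean` (prime part); supporting stmt-RiemannHypothesis-0098).  The polar part
`ĝ(0)·conj ĝ'(0) + ĝ(1)·conj ĝ'(1)` of Weil's functional in the window's Fourier basis `χ_n = (2a)^{−1/2}e^{iω_n x}1_{[−a,a]}`,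
`ω_n = πn/a`, needs the Mellin/Laplace values `∫_{−a}^{a} e^{iω_n x} e^{σ x} dx` at `σ = ∓½`; because `ω_n a = πn`
the endpoint exponentials are `(−1)^n e^{±σa}`:

* `WeilFormatC.integral_cexp_window_laplace` — for real `σ ≠ 0`, real `a`, integer `n` with `a ≠ 0`:
  **`∫_{−a}^{a} e^{(σ + iπn/a)x} dx = (−1)^n (e^{σa} − e^{−σa})/(σ + iπn/a)`**,
  the source of Yoshida's polar entries `Polar(n,m) = (4s²/a)(−1)^{n+m}(1 − 4ω_nω_m)/((1+4ω_n²)(1+4ω_m²))`,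
  `s² = (e^{a/2} − e^{−a/2})²` [Yoshida 1992, (5.15)–(5.16)] (take `σ = ∓½` and multiply out).

Pure calculus; standard axioms only.
-/

-- `Summit.RiemannHypothesis.RiemannHypothesis.…` is the layout-mandated namespace (summit = problem name).
set_option linter.dupNamespace false

noncomputable section

open Complex MeasureTheory intervalIntegral
open scoped Real

namespace Summit.RiemannHypothesis.RiemannHypothesis.Theorems.WeilFormatC

/-- **Window Laplace integral.**  For real `σ ≠ 0`, `a ≠ 0` and an integer `n`,
`∫_{−a}^{a} e^{(σ + iπn/a)x} dx = (−1)^n·(e^{σa} − e^{−σa})/(σ + iπn/a)`. -/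
theorem integral_cexp_window_laplace {a σ : ℝ} (ha : a ≠ 0) (hσ : σ ≠ 0) (n : ℤ) :
    ∫ x in (-a)..a, cexp (((σ : ℂ) + I * ((π * n / a : ℝ) : ℂ)) * x)
      = (-1 : ℂ) ^ n * (((Real.exp (σ * a) : ℝ) : ℂ) - ((Real.exp (-(σ * a)) : ℝ) : ℂ))
        / ((σ : ℂ) + I * ((π * n / a : ℝ) : ℂ)) := by
  set c : ℂ := (σ : ℂ) + I * ((π * n / a : ℝ) : ℂ) with hc
  have hc0 : c ≠ 0 := by
    intro h
    have := congrArg Complex.re h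
    simp [hc] at this
    exact hσ this
  have hac : (a : ℂ) ≠ 0 := ofReal_ne_zero.mpr ha
  rw [integral_exp_mul_complex hc0]
  -- endpoint exponents: c·(±a) = ±σa ± iπn
  have hca : c * (a : ℝ) = ((σ * a : ℝ) : ℂ) + (n : ℂ) * (π * I) := by
    rw [hc]; push_cast; field_simp
  have hcb : c * ((-a : ℝ) : ℂ) = ((-(σ * a) : ℝ) : ℂ) + -((n : ℂ) * (π * I)) := by
    rw [hc]; push_cast; field_simp; ring
  have hpow : cexp ((n : ℂ) * (π * I)) = (-1 : ℂ) ^ n := by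
    rw [Complex.exp_int_mul, Complex.exp_pi_mul_I]
  have hpow' : cexp (-((n : ℂ) * (π * I))) = (-1 : ℂ) ^ n := by
    rw [Complex.exp_neg, hpow, ← inv_zpow, inv_neg, inv_one]
  rw [hca, hcb, Complex.exp_add, Complex.exp_add, hpow, hpow', ← Complex.ofReal_exp, ← Complex.ofReal_exp]
  ring

/-- The two values used by the polar term: `σ = −½` (for `ĝ(0)`, additive variable `ĝ(s) = ∫ g(x)e^{(s−½)x}dx`) and
`σ = ½` (for `ĝ(1)`), packaged: `e^{σa} − e^{−σa}` at `σ = ±½` is `±(e^{a/2} − e^{−a/2})`, so both integrals carry the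
factor `s = e^{a/2} − e^{−a/2}` of Yoshida's `s²`. -/
theorem exp_half_sub_exp_neg_half (a : ℝ) :
    Real.exp (1 / 2 * a) - Real.exp (-(1 / 2 * a)) = Real.exp (a / 2) - Real.exp (-(a / 2)) ∧
    Real.exp (-(1 / 2) * a) - Real.exp (-(-(1 / 2) * a)) = -(Real.exp (a / 2) - Real.exp (-(a / 2))) := by
  constructor
  · rw [show (1 : ℝ) / 2 * a = a / 2 by ring]
  · rw [show -((1 : ℝ) / 2) * a = -(a / 2) by ring, neg_neg]; ring

end Summit.RiemannHypothesis.RiemannHypothesis.Theorems.WeilFormatC
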